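import Literature.Barriers.CriticalPhenomena.PlanarEdwardsModelDiffusiveStoll
import Literature.Barriers.CriticalPhenomena.PlanarEdwardsModelDiffusiveProofs
import Literature.Barriers.CriticalPhenomena.PlanarEdwardsModelDiffusiveSRWMaximal
import Mathlib.Probability.UniformOn
import Literature.Probability.Process.PathSpaceTightnessUnitInterval
import HarnessLib

/-!
# Tightness of the diffusively rescaled planar simple random walks (Donsker, half (D-a))

Sibling proof file of `Literature.Barriers.CriticalPhenomena.PlanarEdwardsModelDiffusiveStoll`:
the laws on `C([0,1], ℂ)` of the polygonal rescaled walks `Edwards2D.scaledPath n ω`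
(`Δx = √(2/n)`, `ω` uniform on the `4ⁿ` nearest-neighbour walks) form a TIGHT family —
`Edwards2D.isTightMeasureSet_scaledPath`, the hypothesis (D-a) of
`Edwards2D.Stoll1989_invariance_of_isTight_of_fdd_of_mollify` — PROVED by Billingsley's
Theorem 7.3 criterion (`Literature.Probability.Process.isTightMeasureSet_range_map_of_modulus_unitInterval`):

1. the path on a grid cell is the linear interpolation (`scaledPath_apply_of_mem_cell`), hence
   within `√(2/n)` of the last grid point (`norm_scaledPath_sub_grid_le`), so a modulus event
   `‖W̄_n(s) - W̄_n(t)‖ ≥ ε`, `|s - t| ≤ δ` forces, for `n ≥ 32/ε²`, two grid times at distance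
   `≤ ⌊nδ⌋ + 1` with `|ω(a) - ω(b)|² ≥ ε²n/8` (`exists_window_of_modulus`);
2. such a window lies in one of the `(n-1)/L + 1` double blocks of length `2L`, `L = ⌊nδ⌋ + 1`,
   where some increment from the block start is `≥ ε²n/32` in `|·|²` (`exists_block_of_window`);
3. restart at the block start and truncation (`expect_increments_from`, `expect_pos_upto`: the
   Markov property at deterministic times, via `expect_append`) reduce each block to the running
   maximum of a fresh walk, bounded by Lévy's maximal inequality and the fourth moment
   (`PlanarEdwardsModelDiffusiveSRWMaximal`: `P[max_{k≤K}|ω(k)|² ≥ c] ≤ 4K²/c²`), whence the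
   union bound `≤ 98304 δ/ε⁴` (`expect_ite_exists_window_le`, `block_bound_le`);
4. the finitely many small `n` are uniformly equicontinuous (`exists_delta_of_lt`); the paths
   start at `0` (`scaledPath_apply_zero`).

## References

* P. Billingsley, *Convergence of Probability Measures*, 2nd ed. (1999), Theorems 7.3, 7.4, 8.2.
-/

noncomputable section

open MeasureTheory ProbabilityTheory Filter Topology Finset unitInterval
open scoped NNReal ENNReal BigOperators

namespace Literature.Barriers.CriticalPhenomena

namespace Edwards2D

open Literature.Probability.LatticeModels Literature.Probability.Percolation
open Literature.Probability.RandomPlanarGeometry.SAW.Zd (normSq)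


variable {n : ℕ}

/-! ### Uniform measure of an event as the average of its indicator -/

open Classical in
/-- On the finite type of `n`-step walks, the uniform probability of an event is the uniform
average of its indicator. [folklore] -/
theorem uniformOn_univ_apply_eq_ofReal_expect (S : Set (StepSeq n)) :
    (uniformOn (Set.univ : Set (StepSeq n))) S =
      ENNReal.ofReal (𝔼 ω : StepSeq n, if ω ∈ S then (1 : ℝ) else 0) := by
  rw [uniformOn_univ, Measure.count_apply_finite _ (Set.toFinite S), Finset.expect_eq_sum_div_card,
    Finset.sum_boole, Finset.card_univ]
  rw [ENNReal.ofReal_div_of_pos (by exact_mod_cast Fintype.card_pos), ENNReal.ofReal_natCast,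
    ENNReal.ofReal_natCast]
  congr 2
  exact congrArg _ (Finset.ext fun ω => by simp)

/-! ### Running maximum of increments after a fixed time (restart + Lévy) -/

open Classical in
/-- **Restart at time `j`**: the increments `ω(j+k) - ω(j)` of an `(j+r)`-step walk are the
positions of a fresh `r`-step walk (Markov property at the deterministic time `j`), for uniform
averages of functions of finitely many increments. [cite: Lawler1991, §1.3 (Theorem 1.3.2)] -/
theorem expect_increments_from {j r : ℕ} (F : (ℕ → Site 2) → ℝ) :
    𝔼 ω : StepSeq (j + r), F (fun k => pos ω (j + k) - pos ω j) =
      𝔼 β : StepSeq r, F (fun k => pos β k) := by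
  rw [expect_append (m := j) (k := r)]
  have : ∀ (α : StepSeq j) (β : StepSeq r),
      (fun k => pos (Fin.append α β : StepSeq (j + r)) (j + k) - pos (Fin.append α β : StepSeq (j + r)) j) =
        fun k => pos β k := by
    intro α β; funext k
    have h0 : pos (Fin.append α β : StepSeq (j + r)) j = endpoint α := by
      simpa [pos_zero] using pos_append_right α β 0
    rw [pos_append_right, h0, add_sub_cancel_left]
  simp_rw [this]
  exact Finset.expect_const Finset.univ_nonempty _

open Classical in
/-- Truncation: the positions up to time `K` of a `(K+r)`-step walk are those of a `K`-step
walk. [folklore] -/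
theorem expect_pos_upto {K r : ℕ} (F : (ℕ → Site 2) → ℝ)
    (hF : ∀ p q : ℕ → Site 2, (∀ k ≤ K, p k = q k) → F p = F q) :
    𝔼 β : StepSeq (K + r), F (fun k => pos β k) = 𝔼 β : StepSeq K, F (fun k => pos β k) := by
  rw [expect_append (m := K) (k := r)]
  refine Finset.expect_congr rfl fun α _ => ?_
  have : ∀ γ : StepSeq r, F (fun k => pos (Fin.append α γ : StepSeq (K + r)) k) = F fun k => pos α k :=
    fun γ => hF _ _ fun k hk => pos_append_left α γ hk
  simp_rw [this]
  exact Finset.expect_const Finset.univ_nonempty _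

open Classical in
/-- **Tail of the running maximum of the increments after time `j`**: for `c > 0`,
`P[∃ k ≤ K, |ω(j+k) - ω(j)|² ≥ c] ≤ 4K²/c²` (restart at `j`, truncation/saturation at the
available number of steps, Lévy's inequality and the fourth moment). [cite: Billingsley1999, §10] -/
theorem expect_ite_exists_normSq_incr_le {j K : ℕ} (hjn : j ≤ n) {c : ℝ} (hc : 0 < c) :
    𝔼 ω : StepSeq n, (if ∃ k ≤ K, c ≤ normSq (pos ω (j + k) - pos ω j) then (1 : ℝ) else 0) ≤
      4 * (K : ℝ) ^ 2 / c ^ 2 := by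
  obtain ⟨r, rfl⟩ := Nat.exists_eq_add_of_le hjn
  rw [expect_increments_from (j := j) (r := r)
    (F := fun p => if ∃ k ≤ K, c ≤ normSq (p k) then (1 : ℝ) else 0)]
  -- compare `K` with the available number of steps `r`
  rcases le_or_gt K r with hKr | hrK
  · obtain ⟨r', rfl⟩ := Nat.exists_eq_add_of_le hKr
    rw [expect_pos_upto (K := K) (r := r')
      (F := fun p => if ∃ k ≤ K, c ≤ normSq (p k) then (1 : ℝ) else 0)]
    · refine (expect_ite_exists_normSq_pos_le_of_pos K hc).trans ?_
      rw [mul_div_assoc']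
      exact div_le_div_of_nonneg_right (by nlinarith [(Nat.cast_nonneg K : (0 : ℝ) ≤ K)])
        (by positivity)
    · intro p q hpq
      have : (∃ k ≤ K, c ≤ normSq (p k)) ↔ ∃ k ≤ K, c ≤ normSq (q k) :=
        ⟨fun ⟨k, hk, h⟩ => ⟨k, hk, by rw [← hpq k hk]; exact h⟩,
          fun ⟨k, hk, h⟩ => ⟨k, hk, by rw [hpq k hk]; exact h⟩⟩
      simp only [this]
  · -- saturation: positions are constant after time `r`
    have hmono : ∀ β : StepSeq r, (∃ k ≤ K, c ≤ normSq (pos β k)) → ∃ k ≤ r, c ≤ normSq (pos β k) := by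
      rintro β ⟨k, hk, h⟩
      rcases le_or_gt k r with hkr | hrk
      · exact ⟨k, hkr, h⟩
      · exact ⟨r, le_rfl, by rw [pos_eq_endpoint, ← pos_of_le β hrk.le]; exact h⟩
    calc 𝔼 β : StepSeq r, (if ∃ k ≤ K, c ≤ normSq (pos β k) then (1 : ℝ) else 0)
        ≤ 𝔼 β : StepSeq r, (if ∃ k ≤ r, c ≤ normSq (pos β k) then (1 : ℝ) else 0) := by
          refine Finset.expect_le_expect fun β _ => ?_
          split_ifs with h1 h2
          · exact le_rfl
          · exact absurd (hmono β h1) h2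
          · exact zero_le_one
          · exact le_rfl
      _ ≤ 2 * ((2 * (r : ℝ) ^ 2 - r) / c ^ 2) := expect_ite_exists_normSq_pos_le_of_pos r hc
      _ ≤ 4 * (K : ℝ) ^ 2 / c ^ 2 := by
          rw [mul_div_assoc']
          have : (r : ℝ) ≤ K := by exact_mod_cast hrK.le
          exact div_le_div_of_nonneg_right
            (by nlinarith [(Nat.cast_nonneg r : (0 : ℝ) ≤ r)]) (by positivity)


/-! ### Blocks: a short window of times lies in a double block -/

/-- `|x - y|² ≤ 2|x|² + 2|y|²` on `ℤ²`. [folklore] -/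
theorem normSq_sub_le (x y : Site 2) : normSq (x - y) ≤ 2 * normSq x + 2 * normSq y := by
  simp only [normSq, Fin.sum_univ_two, Pi.sub_apply, Int.cast_sub]
  nlinarith [sq_nonneg ((x 0 : ℝ) + y 0), sq_nonneg ((x 1 : ℝ) + y 1)]

/-- **Window-to-block reduction**: if two times `a, b < n` at distance `≤ W ≤ L` (`L ≥ 1`) see a
displacement `|ω(a) - ω(b)|² ≥ c`, then in the double block starting at `qL ≤ min(a,b)`,
`q = min(a,b)/L ≤ (n-1)/L`, some increment from the block start has `|ω(qL+k) - ω(qL)|² ≥ c/4`,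
`k ≤ 2L`. [cite: Billingsley1999, proof of Theorem 7.4 ((7.11)–(7.12))] -/
theorem exists_block_of_window {L W a b : ℕ} (hL : 1 ≤ L) (hWL : W ≤ L) (ha : a < n) (hb : b < n)
    (hab : a ≤ b + W) (hba : b ≤ a + W) (ω : StepSeq n) {c : ℝ}
    (hc : c ≤ normSq (pos ω a - pos ω b)) :
    ∃ q ≤ (n - 1) / L, ∃ k ≤ 2 * L, c / 4 ≤ normSq (pos ω (q * L + k) - pos ω (q * L)) := by
  set q := min a b / L with hq
  have hqmin : q * L ≤ min a b := Nat.div_mul_le_self _ _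
  have hminq : min a b < q * L + L := by
    have := Nat.lt_mul_div_succ (min a b) hL
    rw [hq]; linarith [Nat.succ_mul (min a b / L) L, this, mul_comm ((min a b) / L) L]
  have haq : q * L ≤ a := hqmin.trans (min_le_left _ _)
  have hbq : q * L ≤ b := hqmin.trans (min_le_right _ _)
  have ha2 : a ≤ q * L + 2 * L := by
    rcases le_total a b with h | h
    · rw [min_eq_left h] at hminq; omega
    · rw [min_eq_right h] at hminq; omega
  have hb2 : b ≤ q * L + 2 * L := by
    rcases le_total a b with h | h
    · rw [min_eq_left h] at hminq; omega
    · rw [min_eq_right h] at hminq; omega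
  refine ⟨q, Nat.div_le_div_right (by omega), ?_⟩
  -- split the displacement through the block start
  have hsplit : pos ω a - pos ω b =
      (pos ω (q * L + (a - q * L)) - pos ω (q * L)) - (pos ω (q * L + (b - q * L)) - pos ω (q * L)) := by
    rw [Nat.add_sub_cancel' haq, Nat.add_sub_cancel' hbq]; abel
  rw [hsplit] at hc
  have h2 := hc.trans (normSq_sub_le _ _)
  by_cases hA : c / 4 ≤ normSq (pos ω (q * L + (a - q * L)) - pos ω (q * L))
  · exact ⟨a - q * L, by omega, hA⟩
  · refine ⟨b - q * L, by omega, ?_⟩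
    rw [not_le] at hA
    linarith

open Classical in
/-- **Union bound over blocks**: the probability that two times `a, b < n` at distance `≤ W`
(`W ≤ L`, `L ≥ 1`) see `|ω(a) - ω(b)|² ≥ c` is at most `((n-1)/L + 1) · 256 L²/c²`
(`(n-1)/L + 1` double blocks, each controlled by `expect_ite_exists_normSq_incr_le` with `K = 2L`
and threshold `c/4`). [cite: Billingsley1999, proof of Theorem 7.4 and §10] -/
theorem expect_ite_exists_window_le {L W : ℕ} (hL : 1 ≤ L) (hWL : W ≤ L) {c : ℝ} (hc : 0 < c) :
    𝔼 ω : StepSeq n, (if ∃ a b : ℕ, a < n ∧ b < n ∧ a ≤ b + W ∧ b ≤ a + W ∧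
        c ≤ normSq (pos ω a - pos ω b) then (1 : ℝ) else 0) ≤
      (((n - 1) / L + 1 : ℕ) : ℝ) * (256 * (L : ℝ) ^ 2 / c ^ 2) := by
  set Q : Finset ℕ := Finset.range ((n - 1) / L + 1) with hQ
  have hpt : ∀ ω : StepSeq n,
      (if ∃ a b : ℕ, a < n ∧ b < n ∧ a ≤ b + W ∧ b ≤ a + W ∧ c ≤ normSq (pos ω a - pos ω b)
        then (1 : ℝ) else 0) ≤
      ∑ q ∈ Q, (if ∃ k ≤ 2 * L, c / 4 ≤ normSq (pos ω (q * L + k) - pos ω (q * L))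
        then (1 : ℝ) else 0) := by
    intro ω
    split_ifs with h
    · obtain ⟨a, b, ha, hb, hab, hba, hcn⟩ := h
      obtain ⟨q, hq, k, hk, hck⟩ := exists_block_of_window hL hWL ha hb hab hba ω hcn
      have hqQ : q ∈ Q := by rw [hQ, Finset.mem_range]; omega
      refine le_trans ?_ (Finset.single_le_sum (f := fun q => if ∃ k ≤ 2 * L,
        c / 4 ≤ normSq (pos ω (q * L + k) - pos ω (q * L)) then (1 : ℝ) else 0)
        (fun q _ => by positivity) hqQ)
      rw [if_pos ⟨k, hk, hck⟩]
    · exact Finset.sum_nonneg fun q _ => by positivity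
  refine (Finset.expect_le_expect fun ω _ => hpt ω).trans ?_
  rw [Finset.expect_sum_comm]
  have hterm : ∀ q ∈ Q, 𝔼 ω : StepSeq n, (if ∃ k ≤ 2 * L,
      c / 4 ≤ normSq (pos ω (q * L + k) - pos ω (q * L)) then (1 : ℝ) else 0) ≤
      4 * ((2 * L : ℕ) : ℝ) ^ 2 / (c / 4) ^ 2 := by
    intro q hq
    have hqn : q * L ≤ n := by
      rw [hQ, Finset.mem_range] at hq
      have h1 : q ≤ (n - 1) / L := by omega
      have h2 := Nat.div_mul_le_self (n - 1) L
      have h3 := Nat.mul_le_mul_right L h1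
      omega
    exact expect_ite_exists_normSq_incr_le hqn (by positivity)
  refine (Finset.sum_le_sum hterm).trans ?_
  rw [Finset.sum_const, hQ, Finset.card_range, nsmul_eq_mul]
  refine le_of_eq ?_
  push_cast
  field_simp
  ring

/-! ### From the path modulus to lattice displacements -/

/-- `‖x‖² = |x|²` for the embedding `ℤ² ⊆ ℂ`. [folklore] -/
theorem norm_toComplex_sq (x : Site 2) : ‖Site.toComplex x‖ ^ 2 = normSq x := by
  rw [Complex.sq_norm, Complex.normSq_apply]
  simp [normSq, Fin.sum_univ_two, sq]

/-! ### The rescaled polygonal path on a grid cell -/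

/-- `hat` vanishes outside `(-1, 1)`. [folklore] -/
theorem hat_eq_zero_of_one_le_abs {u : ℝ} (hu : 1 ≤ |u|) : hat u = 0 := by
  simp [hat, hu]

/-- `hat u = 1 - |u|` on `[-1, 1]`. [folklore] -/
theorem hat_eq_of_abs_le_one {u : ℝ} (hu : |u| ≤ 1) : hat u = 1 - |u| := by
  simp [hat, hu]

/-- The four unit steps have complex modulus `1`. [folklore] -/
theorem norm_toComplex_stepVec (a : Fin 4) : ‖Site.toComplex (stepVec a)‖ = 1 := by
  fin_cases a <;> simp [Site.toComplex, Complex.norm_def, Complex.normSq]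

/-- **The rescaled path on a grid cell**: for `j/n ≤ t ≤ (j+1)/n` (`j < n`),
`W̄_n(ω)(t) = √(2/n) ((1 - θ) ω(j) + θ ω(j+1))` with `θ = nt - j` (linear interpolation).
[folklore] -/
theorem scaledPath_apply_of_mem_cell (ω : StepSeq n) {j : ℕ} (hj : j < n) (t : I)
    (h1 : (j : ℝ) ≤ n * (t : ℝ)) (h2 : (n : ℝ) * (t : ℝ) ≤ j + 1) :
    scaledPath n ω t = (Real.sqrt (2 / n) : ℂ) *
      (((1 - ((n : ℝ) * (t : ℝ) - j) : ℝ) : ℂ) * Site.toComplex (pos ω j) +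
        ((((n : ℝ) * (t : ℝ) - j) : ℝ) : ℂ) * Site.toComplex (pos ω (j + 1))) := by
  have hθ0 : 0 ≤ (n : ℝ) * (t : ℝ) - j := by linarith
  have hθ1 : (n : ℝ) * (t : ℝ) - j ≤ 1 := by linarith
  have hj0 : hat ((n : ℝ) * (t : ℝ) - j) = 1 - ((n : ℝ) * (t : ℝ) - j) := by
    rw [hat_eq_of_abs_le_one (by rw [abs_of_nonneg hθ0]; exact hθ1), abs_of_nonneg hθ0]
  have hj1 : hat ((n : ℝ) * (t : ℝ) - ((j + 1 : ℕ) : ℝ)) = (n : ℝ) * (t : ℝ) - j := by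
    have e : (n : ℝ) * (t : ℝ) - ((j + 1 : ℕ) : ℝ) = ((n : ℝ) * (t : ℝ) - j) - 1 := by
      push_cast; ring
    rw [e, hat_eq_of_abs_le_one (by rw [abs_of_nonpos (by linarith)]; linarith),
      abs_of_nonpos (by linarith)]
    ring
  simp only [scaledPath, ContinuousMap.coe_mk]
  congr 1
  rw [Finset.sum_eq_add j (j + 1) (by omega), hj0, hj1]
  · intro k _ hkj
    rw [hat_eq_zero_of_one_le_abs, Complex.ofReal_zero, zero_mul]
    rcases lt_or_gt_of_ne hkj.1 with hlt | hgt
    · have : (k : ℝ) + 1 ≤ j := by exact_mod_cast hlt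
      rw [abs_of_nonneg (by linarith)]
      linarith
    · have hk2 : j + 1 < k := lt_of_le_of_ne (Nat.succ_le_of_lt hgt) (Ne.symm hkj.2)
      have : (j : ℝ) + 2 ≤ k := by exact_mod_cast hk2
      rw [abs_of_nonpos (by linarith)]
      linarith
  · intro hjn
    exact absurd (mem_range.2 (by omega)) hjn
  · intro hjn
    exact absurd (mem_range.2 (by omega)) hjn

/-- **The rescaled path stays within one lattice spacing of the last grid point**: for
`j/n ≤ t ≤ (j+1)/n`, `‖W̄_n(ω)(t) - √(2/n) ω(j)‖ ≤ √(2/n)`. [folklore] -/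
theorem norm_scaledPath_sub_grid_le (ω : StepSeq n) {j : ℕ} (hj : j < n) (t : I)
    (h1 : (j : ℝ) ≤ n * (t : ℝ)) (h2 : (n : ℝ) * (t : ℝ) ≤ j + 1) :
    ‖scaledPath n ω t - (Real.sqrt (2 / n) : ℂ) * Site.toComplex (pos ω j)‖ ≤ Real.sqrt (2 / n) := by
  have toComplex_add : ∀ x y : Site 2,
      Site.toComplex (x + y) = Site.toComplex x + Site.toComplex y :=
    fun x y => Complex.ext (by simp) (by simp)
  rw [scaledPath_apply_of_mem_cell ω hj t h1 h2, pos_succ ω hj, toComplex_add]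
  set θ : ℝ := (n : ℝ) * (t : ℝ) - j with hθ
  have hθ0 : 0 ≤ θ := by rw [hθ]; linarith
  have hθ1 : θ ≤ 1 := by rw [hθ]; linarith
  have : (Real.sqrt (2 / n) : ℂ) *
        (((1 - θ : ℝ) : ℂ) * Site.toComplex (pos ω j) +
          ((θ : ℝ) : ℂ) * (Site.toComplex (pos ω j) + Site.toComplex (stepVec (ω ⟨j, hj⟩)))) -
      (Real.sqrt (2 / n) : ℂ) * Site.toComplex (pos ω j) =
      (Real.sqrt (2 / n) : ℂ) * (((θ : ℝ) : ℂ) * Site.toComplex (stepVec (ω ⟨j, hj⟩))) := by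
    push_cast; ring
  rw [this, norm_mul, norm_mul, Complex.norm_real, Complex.norm_real, norm_toComplex_stepVec,
    mul_one, Real.norm_of_nonneg (Real.sqrt_nonneg _), Real.norm_of_nonneg hθ0]
  exact mul_le_of_le_one_right (Real.sqrt_nonneg _) hθ1

/-- Every time in `[0,1]` lies in a grid cell `[j/n, (j+1)/n]` with `j < n` (`n ≥ 1`). [folklore] -/
theorem exists_cell (hn : 0 < n) (t : I) :
    ∃ j : ℕ, j < n ∧ (j : ℝ) ≤ n * (t : ℝ) ∧ (n : ℝ) * (t : ℝ) ≤ j + 1 := by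
  have ht0 : 0 ≤ (n : ℝ) * (t : ℝ) := by have := t.2.1; positivity
  have ht1 : (n : ℝ) * (t : ℝ) ≤ n := by have := t.2.2; nlinarith [(Nat.cast_nonneg n : (0:ℝ) ≤ n)]
  refine ⟨min ⌊(n : ℝ) * (t : ℝ)⌋₊ (n - 1), ?_, ?_, ?_⟩
  · omega
  · refine le_trans ?_ (Nat.floor_le ht0)
    exact_mod_cast min_le_left _ _
  · rcases le_or_gt ⌊(n : ℝ) * (t : ℝ)⌋₊ (n - 1) with h | h
    · rw [min_eq_left h]
      exact (Nat.lt_floor_add_one _).le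
    · rw [min_eq_right h.le]
      have : ((n - 1 : ℕ) : ℝ) + 1 = n := by
        rw [Nat.cast_sub (by omega)]; push_cast; ring
      rw [this]; exact ht1

/-- **Discretisation of the modulus of continuity of the rescaled path**: for `n ≥ 1` and
`s, t ∈ [0,1]` there are grid indices `a, b ≤ n` with `|a - b| ≤ n|s - t| + 1` and
`‖W̄_n(s) - W̄_n(t)‖ ≤ 2√(2/n) + √(2/n) ‖ω(a) - ω(b)‖`. [folklore] -/
theorem norm_scaledPath_sub_le (hn : 0 < n) (ω : StepSeq n) (s t : I) :
    ∃ a b : ℕ, a < n ∧ b < n ∧ |(a : ℝ) - b| ≤ n * |(s : ℝ) - t| + 1 ∧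
      ‖scaledPath n ω s - scaledPath n ω t‖ ≤ 2 * Real.sqrt (2 / n) +
        Real.sqrt (2 / n) * ‖Site.toComplex (pos ω a) - Site.toComplex (pos ω b)‖ := by
  obtain ⟨a, ha, ha1, ha2⟩ := exists_cell hn s
  obtain ⟨b, hb, hb1, hb2⟩ := exists_cell hn t
  refine ⟨a, b, ha, hb, ?_, ?_⟩
  · rw [abs_le]
    constructor
    · have := abs_nonneg ((s : ℝ) - t)
      rw [abs_sub_comm] 
      have h := (le_abs_self ((t : ℝ) - s))
      nlinarith [(Nat.cast_nonneg n : (0:ℝ) ≤ n), h]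
    · have h := (le_abs_self ((s : ℝ) - t))
      nlinarith [(Nat.cast_nonneg n : (0:ℝ) ≤ n), h]
  · have e1 := norm_scaledPath_sub_grid_le ω ha s ha1 ha2
    have e2 := norm_scaledPath_sub_grid_le ω hb t hb1 hb2
    calc ‖scaledPath n ω s - scaledPath n ω t‖
        = ‖(scaledPath n ω s - (Real.sqrt (2 / n) : ℂ) * Site.toComplex (pos ω a)) +
            ((Real.sqrt (2 / n) : ℂ) * Site.toComplex (pos ω a) -
              (Real.sqrt (2 / n) : ℂ) * Site.toComplex (pos ω b)) -
            (scaledPath n ω t - (Real.sqrt (2 / n) : ℂ) * Site.toComplex (pos ω b))‖ := by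
          congr 1; ring
      _ ≤ ‖scaledPath n ω s - (Real.sqrt (2 / n) : ℂ) * Site.toComplex (pos ω a)‖ +
            ‖(Real.sqrt (2 / n) : ℂ) * Site.toComplex (pos ω a) -
              (Real.sqrt (2 / n) : ℂ) * Site.toComplex (pos ω b)‖ +
            ‖scaledPath n ω t - (Real.sqrt (2 / n) : ℂ) * Site.toComplex (pos ω b)‖ :=
          norm_sub_le_of_le (norm_add_le _ _) le_rfl
      _ ≤ Real.sqrt (2 / n) + Real.sqrt (2 / n) * ‖Site.toComplex (pos ω a) - Site.toComplex (pos ω b)‖ +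
            Real.sqrt (2 / n) := by
          gcongr
          rw [← mul_sub, norm_mul, Complex.norm_real, Real.norm_of_nonneg (Real.sqrt_nonneg _)]
      _ = _ := by ring


/-- **From the path modulus to a lattice displacement** (`n` large: `2√(2/n) ≤ ε/2`): if
`dist s t ≤ δ` and `‖W̄_n(s) - W̄_n(t)‖ ≥ ε`, then two grid times `a, b < n` at distance
`≤ ⌊nδ⌋ + 1` satisfy `|ω(a) - ω(b)|² ≥ ε² n / 8`. [folklore] -/
theorem exists_window_of_modulus (hn : 0 < n) {ε : ℝ} (hε : 0 < ε)
    (hnε : 2 * Real.sqrt (2 / n) ≤ ε / 2) {δ : ℝ} (hδ : 0 ≤ δ) (ω : StepSeq n) (s t : I)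
    (hst : dist s t ≤ δ) (hd : ε ≤ dist (scaledPath n ω s) (scaledPath n ω t)) :
    ∃ a b : ℕ, a < n ∧ b < n ∧ a ≤ b + (⌊(n : ℝ) * δ⌋₊ + 1) ∧ b ≤ a + (⌊(n : ℝ) * δ⌋₊ + 1) ∧
      ε ^ 2 * n / 8 ≤ normSq (pos ω a - pos ω b) := by
  obtain ⟨a, b, ha, hb, hab, hdist⟩ := norm_scaledPath_sub_le hn ω s t
  have hst' : |(s : ℝ) - t| ≤ δ := by rwa [Subtype.dist_eq, Real.dist_eq] at hst
  have habδ : |(a : ℝ) - b| ≤ n * δ + 1 :=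
    hab.trans (by nlinarith [(Nat.cast_nonneg n : (0 : ℝ) ≤ n)])
  have hnδ0 : 0 ≤ (n : ℝ) * δ := by positivity
  -- integer window bounds
  have hW : ∀ {x y : ℕ}, (x : ℝ) - y ≤ n * δ + 1 → x ≤ y + (⌊(n : ℝ) * δ⌋₊ + 1) := by
    intro x y hxy
    by_cases hle : x ≤ y + 1
    · omega
    · have hk : ((x - y - 1 : ℕ) : ℝ) ≤ (n : ℝ) * δ := by
        rw [Nat.cast_sub (by omega), Nat.cast_sub (by omega)]; push_cast; linarith
      have := Nat.le_floor hk
      omega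
  refine ⟨a, b, ha, hb, hW (le_trans (le_abs_self _) habδ),
    hW (le_trans (by rw [abs_sub_comm]; exact le_abs_self _) habδ), ?_⟩
  -- displacement
  rw [dist_eq_norm] at hd
  have h1 : ε / 2 ≤ Real.sqrt (2 / n) * ‖Site.toComplex (pos ω a) - Site.toComplex (pos ω b)‖ := by
    linarith
  have hsq : (2 / (n : ℝ)) * normSq (pos ω a - pos ω b) =
      (Real.sqrt (2 / n) * ‖Site.toComplex (pos ω a) - Site.toComplex (pos ω b)‖) ^ 2 := by
    have toComplex_sub : Site.toComplex (pos ω a - pos ω b) =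
        Site.toComplex (pos ω a) - Site.toComplex (pos ω b) := Complex.ext (by simp) (by simp)
    rw [mul_pow, Real.sq_sqrt (by positivity), ← toComplex_sub, norm_toComplex_sq]
  have h2 : (ε / 2) ^ 2 ≤ (2 / (n : ℝ)) * normSq (pos ω a - pos ω b) := by
    rw [hsq]; exact pow_le_pow_left₀ (by positivity) h1 2
  have hn' : (0 : ℝ) < n := by exact_mod_cast hn
  rw [div_mul_eq_mul_div, le_div_iff₀ hn'] at h2
  nlinarith

/-- The rescaled path starts at the origin. [folklore] -/
theorem scaledPath_apply_zero (ω : StepSeq n) : scaledPath n ω ⟨0, le_rfl, zero_le_one⟩ = 0 := by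
  simp only [scaledPath, ContinuousMap.coe_mk, mul_zero, zero_sub]
  rw [Finset.sum_eq_zero, mul_zero]
  intro k _
  rcases Nat.eq_zero_or_pos k with rfl | hk
  · rw [pos_zero]
    simp [Site.toComplex]
    rfl
  · rw [show (-(k : ℝ)) = ((-(k : ℤ) : ℤ) : ℝ) by push_cast; ring,
      hat_intCast_of_ne_zero (by omega), Complex.ofReal_zero, zero_mul]

/-- **Finitely many `n`**: for `n < N` (finitely many uniformly continuous paths altogether) a
common modulus `δ > 0` serves `ε`. [folklore] -/
theorem exists_delta_of_lt (N : ℕ) {ε : ℝ} (hε : 0 < ε) :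
    ∃ δ : ℝ, 0 < δ ∧ ∀ n < N, ∀ (ω : StepSeq n) (s t : I), dist s t ≤ δ →
      dist (scaledPath n ω s) (scaledPath n ω t) < ε := by
  -- eventually (as `δ → 0⁺`) every single path is fine; finitely many paths
  have hev : ∀ x : (Σ n : Fin N, StepSeq n), ∀ᶠ δ in 𝓝[>] (0 : ℝ), ∀ s t : I, dist s t ≤ δ →
      dist (scaledPath x.1 x.2 s) (scaledPath x.1 x.2 t) < ε := by
    intro x
    obtain ⟨δ₀, hδ₀, h⟩ := Metric.uniformContinuous_iff.1
      (CompactSpace.uniformContinuous_of_continuous (scaledPath x.1 x.2).continuous) ε hε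
    filter_upwards [Ioo_mem_nhdsGT hδ₀] with δ hδ s t hst
    exact h (lt_of_le_of_lt hst hδ.2)
  obtain ⟨δ, hδall, hδpos⟩ := ((eventually_all.2 hev).and (eventually_mem_nhdsWithin)).exists
  refine ⟨δ, hδpos, fun n hn ω s t hst => ?_⟩
  exact hδall ⟨⟨n, hn⟩, ω⟩ s t hst


/-! ### Tightness of the laws of the rescaled planar walks -/

/-- Arithmetic of the block bound: with `L ≤ nδ₀ + 1`, `1 ≤ nδ₀`, `δ₀ ≤ 1`,
`98304 δ₀ ≤ η ε⁴` and `B L ≤ n + L` (number of double blocks `B`), the union bound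
`B · 16384 L²/(ε⁴ n²)` is at most `η`. [folklore] -/
theorem block_bound_le {n L B : ℕ} {δ₀ ε η : ℝ} (hn : 0 < n) (hε : 0 < ε) (hδ₀ : δ₀ ≤ 1)
    (hL : (L : ℝ) ≤ n * δ₀ + 1) (hnδ : 1 ≤ (n : ℝ) * δ₀) (hη : 98304 * δ₀ ≤ η * ε ^ 4)
    (hB : (B : ℝ) * L ≤ n + L) :
    (B : ℝ) * (256 * (L : ℝ) ^ 2 / (ε ^ 2 * n / 8) ^ 2) ≤ η := by
  have hn' : (0 : ℝ) < n := by exact_mod_cast hn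
  have hL0 : (0 : ℝ) ≤ L := Nat.cast_nonneg L
  have hB0 : (0 : ℝ) ≤ B := Nat.cast_nonneg B
  have hL2 : (L : ℝ) ≤ 2 * n * δ₀ := by linarith
  have hδpos : 0 < δ₀ := by nlinarith
  -- `B L² ≤ (n + L) L ≤ 6 n² δ₀`
  have h1 : (B : ℝ) * L ^ 2 ≤ (n + L) * L := by nlinarith
  have h2 : ((n : ℝ) + L) * L ≤ 6 * n ^ 2 * δ₀ := by nlinarith
  rw [show (B : ℝ) * (256 * (L : ℝ) ^ 2 / (ε ^ 2 * n / 8) ^ 2) =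
    16384 * ((B : ℝ) * L ^ 2) / (ε ^ 4 * n ^ 2) by field_simp; ring]
  rw [div_le_iff₀ (by positivity)]
  nlinarith [pow_pos hε 4, pow_pos hn' 2]

open Classical in
/-- **Tightness of the diffusively rescaled planar random walks** (the (D-a) half of Donsker's
theorem for `Edwards2D.scaledPath`): the laws on `C([0,1], ℂ)` of the polygonal paths
`W̄_n(ω)`, `ω` uniform on the `4ⁿ` walks, form a tight family. Billingsley's Theorem 7.3
criterion (`isTightMeasureSet_range_map_of_modulus_unitInterval`): the paths start at `0`, and
the modulus-of-continuity event is controlled, for `n` large, by the window/block reduction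
(`exists_window_of_modulus`, `exists_block_of_window`) and Lévy's maximal inequality with fourth
moments (`expect_ite_exists_window_le`: probability `≤ 98304 δ/ε⁴`), and for the finitely many
small `n` by uniform continuity (`exists_delta_of_lt`).
[cite: Billingsley1999, Theorems 7.3, 7.4 and proof of Theorem 8.2] -/
theorem isTightMeasureSet_scaledPath :
    IsTightMeasureSet (Set.range fun n : ℕ =>
      (uniformOn (Set.univ : Set (StepSeq n))).map (scaledPath n)) := by
  refine Literature.Probability.Process.isTightMeasureSet_range_map_of_modulus_unitInterval
    (P := fun n => uniformOn (Set.univ : Set (StepSeq n))) (X := fun n => scaledPath n)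
    (fun η hη => ⟨{0}, isCompact_singleton, fun n => ?_⟩) (fun ε hε η hη => ?_)
  · -- paths start at the origin
    have : {ω : StepSeq n | scaledPath n ω 0 ∉ ({0} : Set ℂ)} = ∅ := by
      ext ω
      simp only [Set.mem_setOf_eq, Set.mem_singleton_iff, Set.mem_empty_iff_false, iff_false,
        not_not]
      exact scaledPath_apply_zero ω
    rw [this, measure_empty]
    exact bot_le
  · -- the modulus event
    rcases eq_or_ne η ⊤ with rfl | hηtop
    · exact ⟨1, one_pos, fun n => le_top⟩
    have hη' : 0 < η.toReal := ENNReal.toReal_pos hη.ne' hηtop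
    -- large-`n` scale `δ₀` and threshold `N`
    set δ₀ : ℝ := min 1 (η.toReal * ε ^ 4 / 98304) with hδ₀
    have hδ₀pos : 0 < δ₀ := lt_min one_pos (by positivity)
    have hδ₀1 : δ₀ ≤ 1 := min_le_left _ _
    have hδ₀η : 98304 * δ₀ ≤ η.toReal * ε ^ 4 := by
      have := min_le_right 1 (η.toReal * ε ^ 4 / 98304)
      rw [← hδ₀] at this
      linarith [(le_div_iff₀ (by norm_num : (0:ℝ) < 98304)).1 this]
    set N : ℕ := max (⌈32 / ε ^ 2⌉₊ + 1) (⌈1 / δ₀⌉₊ + 1) with hN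
    obtain ⟨δ₁, hδ₁, hsmall⟩ := exists_delta_of_lt N hε
    refine ⟨min δ₀ δ₁, lt_min hδ₀pos hδ₁, fun n => ?_⟩
    rcases lt_or_ge n N with hnN | hnN
    · -- small `n`: the event is empty
      have : {ω : StepSeq n | ∃ s t : I, dist s t ≤ min δ₀ δ₁ ∧
          ε ≤ dist (scaledPath n ω s) (scaledPath n ω t)} = ∅ := by
        ext ω
        simp only [Set.mem_setOf_eq, Set.mem_empty_iff_false, iff_false, not_exists, not_and,
          not_le]
        intro s t hst
        exact hsmall n hnN ω s t (hst.trans (min_le_right _ _))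
      rw [this, measure_empty]
      exact bot_le
    · -- large `n`
      have hn1 : ⌈32 / ε ^ 2⌉₊ + 1 ≤ n := le_trans (le_max_left _ _) hnN
      have hn2 : ⌈1 / δ₀⌉₊ + 1 ≤ n := le_trans (le_max_right _ _) hnN
      have hn : 0 < n := by omega
      have hn' : (0 : ℝ) < n := by exact_mod_cast hn
      have hnε : 2 * Real.sqrt (2 / n) ≤ ε / 2 := by
        have h32 : 32 / ε ^ 2 ≤ n := by
          have := Nat.le_ceil (32 / ε ^ 2)
          have : (⌈32 / ε ^ 2⌉₊ : ℝ) + 1 ≤ n := by exact_mod_cast hn1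
          linarith
        have h2n : 2 / (n : ℝ) ≤ (ε / 4) ^ 2 := by
          rw [div_le_iff₀ hn', div_pow]
          rw [div_le_iff₀ (by positivity)] at h32
          nlinarith
        have : Real.sqrt (2 / n) ≤ ε / 4 := by
          rw [← Real.sqrt_sq (by positivity : (0:ℝ) ≤ ε / 4)]
          exact Real.sqrt_le_sqrt h2n
        linarith
      have hnδ : 1 ≤ (n : ℝ) * δ₀ := by
        have := Nat.le_ceil (1 / δ₀)
        have h' : (⌈1 / δ₀⌉₊ : ℝ) + 1 ≤ n := by exact_mod_cast hn2
        have : 1 / δ₀ ≤ n := by linarith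
        rwa [div_le_iff₀ hδ₀pos] at this
      set L : ℕ := ⌊(n : ℝ) * δ₀⌋₊ + 1 with hL
      have hL1 : 1 ≤ L := by omega
      have hLle : (L : ℝ) ≤ n * δ₀ + 1 := by
        rw [hL]; push_cast; linarith [Nat.floor_le (by positivity : (0:ℝ) ≤ n * δ₀)]
      -- containment in the window event with `W = L`
      have hsub : {ω : StepSeq n | ∃ s t : I, dist s t ≤ min δ₀ δ₁ ∧
            ε ≤ dist (scaledPath n ω s) (scaledPath n ω t)} ⊆
          {ω | ∃ a b : ℕ, a < n ∧ b < n ∧ a ≤ b + L ∧ b ≤ a + L ∧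
            ε ^ 2 * n / 8 ≤ normSq (pos ω a - pos ω b)} := by
        rintro ω ⟨s, t, hst, hd⟩
        obtain ⟨a, b, ha, hb, hab, hba, hc⟩ := exists_window_of_modulus hn hε hnε hδ₀pos.le ω s t
          (hst.trans (min_le_left _ _)) hd
        exact ⟨a, b, ha, hb, hab, hba, hc⟩
      refine (measure_mono hsub).trans ?_
      rw [uniformOn_univ_apply_eq_ofReal_expect, ← ENNReal.ofReal_toReal hηtop]
      refine ENNReal.ofReal_le_ofReal ?_
      refine (expect_ite_exists_window_le (n := n) hL1 le_rfl (c := ε ^ 2 * n / 8)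
        (by positivity)).trans ?_
      refine block_bound_le hn hε hδ₀1 hLle hnδ hδ₀η ?_
      -- number of double blocks: `((n-1)/L + 1) L ≤ n + L`
      have h1 : ((n - 1) / L + 1) * L ≤ n - 1 + L := by
        have := Nat.div_mul_le_self (n - 1) L
        nlinarith
      have h2 : (((n - 1) / L + 1 : ℕ) : ℝ) * L ≤ ((n - 1 + L : ℕ) : ℝ) := by exact_mod_cast h1
      refine h2.trans ?_
      rw [Nat.cast_add, Nat.cast_sub (by omega)]
      push_cast; linarith

end Edwards2D

end Literature.Barriers.CriticalPhenomena

end
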